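/-
Origin: expansion seat `prover-pub-hodgecm-mc-sinst-1-g10-0`, handover #1255 2026-08-21T01:09Z md5 600dcffef010 (229 l.; NEW additive DROP-ALONE generic leaf, ns HodgeCM.LinePair: §1 any comm. ring S, [Unique m]: reindex_kronecker_unique (reindex (prodUnique n m) (A ⊗ₖ B) = B d d • A), unitaryGroupOfForm_smul (U(σ, a • H) = U(σ, H), a unit), reindex_conjForm, def glReindex : GL (n × m) S ≃* GL n S (Units.mapEquiv of Matrix.reindexAlgEquiv) + coe_glReindex, glReindex_mem_unitaryGroupOfForm_iff, map_glReindex_unitaryGroupOfForm, def linePairEquiv σ HV HW (ha : IsUnit (HW d d)) : U(σ, HV ⊗ₖ HW) ≃* U(σ, HV) + coe_linePairEquiv, linePairEquiv_dualPairInl (g ⊗ 1 ↦ g), coe_linePairEquiv_dualPairInr (1 ⊗ u ↦ u d d • 1); §2 number fields: isUnit_adelicForm_line, def adelicLinePairEquiv F E c N JV JW (hJW : JW d d ≠ 0) : adelicPair F E c N 1 JV JW ≃* adelic F E c N JV, def rationalLinePairEquiv, adelicLinePairEquiv_adelicInl, coe_adelicLinePairEquiv_adelicInr, adelicLinePairEquiv_rationalPairToAdelic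 (= toAdelic ∘ rationalLinePairEquiv, rfl) + _mem; §3 def bigCharOfV cV := cV ∘ adelicLinePairEquiv : adelicPair F E c N 1 JV JW →* ℂˣ, bigCharOfV_adelicInl (ĉ (g ⊗ 1) = cV g), twistCharV_bigCharOfV (twistCharV ĉ = cV.comp finAdelicToAdelic), twistCharW_bigCharOfV_apply, bigCharOfV_rationalPairToAdelic (cV = 1 on toAdelic γ ⇒ ĉ (rationalPairToAdelic γ₀) = 1 = SplitLine.IsRatTrivial) + primed range form; NAMES for audit: HodgeCM.LinePair.map_glReindex_unitaryGroupOfForm · HodgeCM.LinePair.twistCharV_bigCharOfV · HodgeCM.LinePair.bigCharOfV_rationalPairToAdelic) (`HOME/mc/pub-hodgecm-mc-sinst-1-g10/stage69/HodgeCM/Model/AdelicLinePair.lean`, md5 600dcffef010, 229 lines);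
landed by the gen-29 packager (p-g29) in gate run 69 as `HodgeCM/Model/AdelicLinePair.lean` (verbatim).
-/
/-
Copyright (c) 2026 the pub-hodgecm formalisation cell (harness21).  New file, not vendored.
Origin: session prover-pub-hodgecm-mc-sinst-1-g10-0 (unit pub-hodgecm-mc-sinst-1-g10, S-INSTANCE CONSTRUCTOR gen 10; DATUM SEAM 2 part (γ),
generic half: for a hermitian LINE `W` the inclusion `a : U(J_V)(𝔸) →* G₁(𝔸) = U(J_V ⊗ J_W)(𝔸)` of [GelbartRogawski1991, §3.2] is an
ISOMORPHISM, so every character of `U(J_V)(𝔸)` is the `V`-part of a character of `G₁(𝔸)`), 2026-08-21.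
Intended final place: `HodgeCM/Model/AdelicLinePair.lean` (NEW additive generic leaf; imports the vendored carriers
`UnitaryGroupDualPairCarriers` and theta-3's `WeilCentralCoinvariants` (for `twistCharV/W`); nothing imports it; drop alone).
-/
import Summits.HodgeConjecture.HodgeCM.Model.WeilCentralCoinvariants_3

set_option autoImplicit false

/-!
# The big group of a dual pair with a LINE: `U(J_V ⊗ (a))(R) = U(J_V)(R)`

For a `1 × 1` Gram matrix `J_W = (a)` with `a` a unit, `J_V ⊗ₖ J_W` reindexed along `n × m ≃ n` (`m` a singleton) is `a • J_V`,
and `U(σ, a • J_V) = U(σ, J_V)`; hence the member `g ↦ g ⊗ 1` of the dual pair ([MoeglinVignerasWaldspurger1987, I.17];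
[GelbartRogawski1991, §3.2 p. 457] `a : U(V) → G₁`) is an isomorphism `U(σ, J_V) ≃* U(σ, J_V ⊗ₖ J_W)` whose inverse is the
reindexing.  KERNEL only (matrix algebra over the tree's carriers):

* § 1 (any commutative ring `S`, `[Unique m]`): `reindex_kronecker_unique` (`(A ⊗ₖ B)♭ = B d d • A`), `unitaryGroupOfForm_smul`
  (`U(σ, a • H) = U(σ, H)` for a unit `a`), **`linePairEquiv σ HV HW ha : U(σ, HV ⊗ₖ HW) ≃* U(σ, HV)`** with
  `coe_linePairEquiv` (the matrix is the reindexed one), **`linePairEquiv_dualPairInl`** (`= id` on `U(σ, HV)`),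
  `coe_linePairEquiv_dualPairInr` (`1 ⊗ u ↦ u d d • 1`), and functoriality in the ring `linePairEquiv_map`;
* § 2 (number fields): **`adelicLinePairEquiv F E c N JV JW hJW : adelicPair F E c N 1 JV JW ≃* adelic F E c N JV`**,
  `rationalLinePairEquiv`, `adelicLinePairEquiv_adelicInl`, **`adelicLinePairEquiv_rationalPairToAdelic`**
  (`= toAdelic ∘ rationalLinePairEquiv`: rational points go to rational points);
* § 3 the BIG CHARACTER OF A `V`-CHARACTER: **`bigCharOfV … cV := cV ∘ adelicLinePairEquiv`**, `bigCharOfV_adelicInl`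
  (`ĉ(g ⊗ 1) = cV g`), **`twistCharV_bigCharOfV`** (`twistCharV ĉ = cV ∘ finAdelicToAdelic`), and
  **`bigCharOfV_rationalPairToAdelic`** (`ĉ = 1` on `G₁(F)` as soon as `cV = 1` on `U(J_V)(F)` — the `IsRatTrivial` input of
  axioms-1's `SplitLine.twistBy`).
0 records, 0 `def … : Prop`, nothing cited as a hypothesis; `#print axioms` ⊆ {propext, Classical.choice, Quot.sound}.
-/

noncomputable section

open scoped Matrix Kronecker
open NumberField IsDedekindDomain
open Literature.NumberTheory.Automorphic Literature.NumberTheory.Automorphic.UnitaryGroup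

namespace HodgeCM
namespace LinePair

/-! ## § 1. Generic ring -/

section Generic

variable {S : Type*} [CommRing S] {n m : Type*} [Fintype n] [DecidableEq n] [Fintype m] [DecidableEq m] [Unique m]

omit [Fintype n] [DecidableEq n] [Fintype m] [DecidableEq m] in
/-- `(A ⊗ₖ B)` reindexed along `n × m ≃ n` (`m` a singleton) is `B d d • A`. [folklore] -/
theorem reindex_kronecker_unique (A : Matrix n n S) (B : Matrix m m S) :
    Matrix.reindex (Equiv.prodUnique n m) (Equiv.prodUnique n m) (A ⊗ₖ B) = B default default • A := by
  ext i j
  simp only [Matrix.reindex_apply, Matrix.submatrix_apply, Equiv.prodUnique_symm_apply, Matrix.kroneckerMap_apply,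
    Matrix.smul_apply, smul_eq_mul, mul_comm (A i j)]

omit [Fintype m] [DecidableEq m] [Unique m] in
/-- `U(σ, a • H) = U(σ, H)` for a unit scalar `a`. [folklore] -/
theorem unitaryGroupOfForm_smul (σ : S →+* S) (H : Matrix n n S) {a : S} (ha : IsUnit a) :
    unitaryGroupOfForm σ (a • H) = unitaryGroupOfForm σ H := by
  ext g
  rw [mem_unitaryGroupOfForm_iff, mem_unitaryGroupOfForm_iff, Matrix.mul_smul, Matrix.smul_mul]
  exact ⟨fun h => ha.smul_left_cancel.1 h, fun h => by rw [h]⟩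

omit [Fintype n] [DecidableEq n] [Fintype m] [DecidableEq m] [Unique m] in
/-- reindexing commutes with the defining expression `(σ M)ᵀ H M` of a unitary group. [folklore] -/
theorem reindex_conjForm {p q : Type*} (σ : S →+* S) (e : p ≃ q) (M H : Matrix p p S) [Fintype p] [Fintype q] :
    Matrix.reindex e e ((M.map σ)ᵀ * H * M) =
      ((Matrix.reindex e e M).map σ)ᵀ * Matrix.reindex e e H * Matrix.reindex e e M := by
  simp only [Matrix.reindex_apply, ← Matrix.submatrix_map, Matrix.transpose_submatrix, Matrix.submatrix_mul_equiv]

/-- the reindexing `GL_{n × m}(S) ≃* GL_n(S)` along `n × m ≃ n`. [folklore] -/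
def glReindex : GL (n × m) S ≃* GL n S :=
  Units.mapEquiv (Matrix.reindexAlgEquiv S S (Equiv.prodUnique n m)).toMulEquiv

/-- (Ported verbatim from the HodgeCMPerL package; no docstring in the source.) -/
@[simp] theorem coe_glReindex (g : GL (n × m) S) :
    ((glReindex g : GL n S) : Matrix n n S) =
      Matrix.reindex (Equiv.prodUnique n m) (Equiv.prodUnique n m) (g : Matrix (n × m) (n × m) S) := rfl

/-- membership transfer along the reindexing. [folklore] -/
theorem glReindex_mem_unitaryGroupOfForm_iff (σ : S →+* S) (H : Matrix (n × m) (n × m) S) (g : GL (n × m) S) :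
    glReindex g ∈ unitaryGroupOfForm σ (Matrix.reindex (Equiv.prodUnique n m) (Equiv.prodUnique n m) H) ↔
      g ∈ unitaryGroupOfForm σ H := by
  rw [mem_unitaryGroupOfForm_iff, mem_unitaryGroupOfForm_iff, coe_glReindex, ← reindex_conjForm,
    (Matrix.reindex _ _).apply_eq_iff_eq]

/-- the reindexing carries `U(σ, HV ⊗ₖ HW)` onto `U(σ, HV)` when `HW d d` is a unit. [folklore] -/
theorem map_glReindex_unitaryGroupOfForm (σ : S →+* S) (HV : Matrix n n S) (HW : Matrix m m S)
    (ha : IsUnit (HW default default)) :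
    (unitaryGroupOfForm σ (HV ⊗ₖ HW)).map (glReindex : GL (n × m) S ≃* GL n S).toMonoidHom = unitaryGroupOfForm σ HV := by
  ext g
  rw [Subgroup.mem_map_equiv, ← glReindex_mem_unitaryGroupOfForm_iff σ (HV ⊗ₖ HW), MulEquiv.apply_symm_apply,
    reindex_kronecker_unique, unitaryGroupOfForm_smul σ HV ha]

/-- **`U(σ, HV ⊗ₖ HW) ≃* U(σ, HV)` for a unit line `HW`** (reindex along `n × m ≃ n`). [folklore] -/
def linePairEquiv (σ : S →+* S) (HV : Matrix n n S) (HW : Matrix m m S) (ha : IsUnit (HW default default)) :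
    unitaryGroupOfForm σ (HV ⊗ₖ HW) ≃* unitaryGroupOfForm σ HV :=
  ((glReindex : GL (n × m) S ≃* GL n S).subgroupMap (unitaryGroupOfForm σ (HV ⊗ₖ HW))).trans
    (MulEquiv.subgroupCongr (map_glReindex_unitaryGroupOfForm σ HV HW ha))

/-- the matrix of `linePairEquiv g` is the reindexed matrix of `g`. [folklore] -/
@[simp] theorem coe_linePairEquiv (σ : S →+* S) (HV : Matrix n n S) (HW : Matrix m m S) (ha : IsUnit (HW default default))
    (g : unitaryGroupOfForm σ (HV ⊗ₖ HW)) :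
    (((linePairEquiv σ HV HW ha g : unitaryGroupOfForm σ HV) : GL n S) : Matrix n n S) =
      Matrix.reindex (Equiv.prodUnique n m) (Equiv.prodUnique n m) ((g : GL (n × m) S) : Matrix (n × m) (n × m) S) := rfl

/-- **`linePairEquiv (g ⊗ 1) = g`.** [folklore] -/
@[simp] theorem linePairEquiv_dualPairInl (σ : S →+* S) (HV : Matrix n n S) (HW : Matrix m m S)
    (ha : IsUnit (HW default default)) (g : unitaryGroupOfForm σ HV) :
    linePairEquiv σ HV HW ha (dualPairInl σ HV HW g) = g := by
  apply Subtype.ext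
  apply Units.ext
  rw [coe_linePairEquiv, dualPairInl_apply, coe_dualPair]
  simp only [OneMemClass.coe_one, Units.val_one, reindex_kronecker_unique, Matrix.one_apply_eq, one_smul]

/-- `linePairEquiv (1 ⊗ u)` has matrix `u d d • 1` (the central element). [folklore] -/
theorem coe_linePairEquiv_dualPairInr (σ : S →+* S) (HV : Matrix n n S) (HW : Matrix m m S)
    (ha : IsUnit (HW default default)) (u : unitaryGroupOfForm σ HW) :
    (((linePairEquiv σ HV HW ha (dualPairInr σ HV HW u) : unitaryGroupOfForm σ HV) : GL n S) : Matrix n n S) =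
      ((u : GL m S) : Matrix m m S) default default • (1 : Matrix n n S) := by
  rw [coe_linePairEquiv, dualPairInr_apply, coe_dualPair]
  simp only [OneMemClass.coe_one, Units.val_one, reindex_kronecker_unique]

end Generic

/-! ## § 2. Number fields: `G₁(𝔸_F) = U(J_V ⊗ J_W)(𝔸_F) ≃* U(J_V)(𝔸_F)` for a line `J_W` -/

section Adelic

variable (F E : Type) [Field F] [NumberField F] [Field E] [NumberField E] [Algebra F E]
  (c : E ≃ₐ[F] E) (N : ℕ) (JV : Matrix (Fin N) (Fin N) E) (JW : Matrix (Fin 1) (Fin 1) E) (hJW : JW default default ≠ 0)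

include hJW in
/-- the adelic line form has a unit entry. [folklore] -/
theorem isUnit_adelicForm_line : IsUnit ((adelicForm E 1 JW) default default) :=
  (isUnit_iff_ne_zero.2 hJW).map (algebraMap E (AdeleRing (𝓞 E) E))

include hJW in
/-- **`G₁(𝔸_F) = U(J_V ⊗ J_W)(𝔸_F) ≃* U(J_V)(𝔸_F)`** for a hermitian LINE `J_W` — the inverse of [GelbartRogawski1991, §3.2]'s
`a : g ↦ g ⊗ 1` (`adelicLinePairEquiv_adelicInl`). [folklore] -/
def adelicLinePairEquiv : adelicPair F E c N 1 JV JW ≃* adelic F E c N JV :=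
  linePairEquiv (conjAdele F E c) (adelicForm E N JV) (adelicForm E 1 JW) (isUnit_adelicForm_line E JW hJW)

include hJW in
/-- the same on rational points: `G₁(F) ≃* U(J_V)(F)`. [folklore] -/
def rationalLinePairEquiv : rationalPair F E c N 1 JV JW ≃* rational F E c N JV :=
  linePairEquiv (c : E →+* E) JV JW (isUnit_iff_ne_zero.2 hJW)

omit [NumberField F] in
/-- **`adelicLinePairEquiv (g ⊗ 1) = g`.** [folklore] -/
@[simp] theorem adelicLinePairEquiv_adelicInl (g : adelic F E c N JV) :
    adelicLinePairEquiv F E c N JV JW hJW (adelicInl F E c N 1 JV JW g) = g :=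
  linePairEquiv_dualPairInl _ _ _ _ g

omit [NumberField F] in
/-- `adelicLinePairEquiv (1 ⊗ u)` is the central element `u • 1_V` (matrix `u₀₀ • 1`). [folklore] -/
theorem coe_adelicLinePairEquiv_adelicInr (u : adelic F E c 1 JW) :
    (((adelicLinePairEquiv F E c N JV JW hJW (adelicInr F E c N 1 JV JW u) : adelic F E c N JV) :
        GL (Fin N) (AdeleRing (𝓞 E) E)) : Matrix (Fin N) (Fin N) (AdeleRing (𝓞 E) E)) =
      ((u : GL (Fin 1) (AdeleRing (𝓞 E) E)) : Matrix (Fin 1) (Fin 1) (AdeleRing (𝓞 E) E)) default default •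
        (1 : Matrix (Fin N) (Fin N) (AdeleRing (𝓞 E) E)) :=
  coe_linePairEquiv_dualPairInr _ _ _ _ u

omit [NumberField F] in
/-- **rational points go to rational points**: `adelicLinePairEquiv ∘ (G₁(F) → G₁(𝔸_F)) = (U(J_V)(F) → U(J_V)(𝔸_F)) ∘
rationalLinePairEquiv` (entrywise `algebraMap` commutes with reindexing). [folklore] -/
theorem adelicLinePairEquiv_rationalPairToAdelic (γ : rationalPair F E c N 1 JV JW) :
    adelicLinePairEquiv F E c N JV JW hJW (rationalPairToAdelic F E c N 1 JV JW γ) =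
      toAdelic F E c N JV (rationalLinePairEquiv F E c N JV JW hJW γ) :=
  Subtype.ext (Units.ext rfl)

omit [NumberField F] in
/-- hence `adelicLinePairEquiv` of a rational point is in the range of `toAdelic`. [folklore] -/
theorem adelicLinePairEquiv_rationalPairToAdelic_mem (γ : rationalPair F E c N 1 JV JW) :
    adelicLinePairEquiv F E c N JV JW hJW (rationalPairToAdelic F E c N 1 JV JW γ) ∈ (toAdelic F E c N JV).range :=
  ⟨rationalLinePairEquiv F E c N JV JW hJW γ, (adelicLinePairEquiv_rationalPairToAdelic F E c N JV JW hJW γ).symm⟩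

/-! ## § 3. The big character of a `V`-character -/

variable (cV : adelic F E c N JV →* ℂˣ)

include hJW in
/-- **`ĉ := c_V ∘ (G₁(𝔸) ≃ U(J_V)(𝔸))`** — the character of the big group `G₁(𝔸_F)` of the pair `(V, line)` whose `V`-part is the
given character `c_V` of `U(J_V)(𝔸_F)` (the `BigChar` of axioms-1's `SplitLine.twistBy` realising a prescribed `V`-twist). -/
def bigCharOfV : adelicPair F E c N 1 JV JW →* ℂˣ :=
  cV.comp (adelicLinePairEquiv F E c N JV JW hJW).toMonoidHom

omit [NumberField F] in
/-- **`ĉ(g ⊗ 1) = c_V(g)`.** [folklore] -/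
@[simp] theorem bigCharOfV_adelicInl (g : adelic F E c N JV) :
    bigCharOfV F E c N JV JW hJW cV (adelicInl F E c N 1 JV JW g) = cV g := by
  rw [bigCharOfV, MonoidHom.comp_apply, MulEquiv.coe_toMonoidHom, adelicLinePairEquiv_adelicInl]

/-- **the `V`-part of `ĉ` is `c_V` on the finite-adelic points**: `twistCharV ĉ = c_V ∘ finAdelicToAdelic` (theta-3's
`HodgeCM.WeilCoinv.twistCharV`). [folklore] -/
theorem twistCharV_bigCharOfV :
    HodgeCM.WeilCoinv.twistCharV F E c N 1 JV JW (bigCharOfV F E c N JV JW hJW cV) =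
      cV.comp (finAdelicToAdelic F E c N JV) := by
  ext k : 1
  rw [HodgeCM.WeilCoinv.twistCharV_apply, bigCharOfV_adelicInl, MonoidHom.comp_apply]
  rfl

/-- the `W`-part of `ĉ`: `twistCharW ĉ u = c_V (u • 1_V)` (the value of `c_V` on the central element of `1 ⊗ (1, u)`). [folklore] -/
theorem twistCharW_bigCharOfV_apply (u : finAdelic F E c 1 JW) :
    HodgeCM.WeilCoinv.twistCharW F E c N 1 JV JW (bigCharOfV F E c N JV JW hJW cV) u =
      cV (adelicLinePairEquiv F E c N JV JW hJW (adelicInr F E c N 1 JV JW (finAdelicToAdelic F E c 1 JW u))) := rfl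

omit [NumberField F] in
/-- **AUTOMORPHY TRANSFER**: if `c_V = 1` on `U(J_V)(F)` then `ĉ = 1` on `G₁(F)` (axioms-1's `SplitLine.IsRatTrivial ĉ`). [folklore] -/
theorem bigCharOfV_rationalPairToAdelic (hcV : ∀ γ : rational F E c N JV, cV (toAdelic F E c N JV γ) = 1)
    (γ₀ : rationalPair F E c N 1 JV JW) :
    bigCharOfV F E c N JV JW hJW cV (rationalPairToAdelic F E c N 1 JV JW γ₀) = 1 := by
  rw [bigCharOfV, MonoidHom.comp_apply, MulEquiv.coe_toMonoidHom, adelicLinePairEquiv_rationalPairToAdelic, hcV]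

omit [NumberField F] in
/-- the same with the rationality hypothesis in RANGE form (`∀ v ∈ range toAdelic, c_V v = 1`, the currency of the tree's
`charV₃₄_eq_one_of_rational`). [folklore] -/
theorem bigCharOfV_rationalPairToAdelic' (hcV : ∀ v ∈ (toAdelic F E c N JV).range, cV v = 1)
    (γ₀ : rationalPair F E c N 1 JV JW) :
    bigCharOfV F E c N JV JW hJW cV (rationalPairToAdelic F E c N 1 JV JW γ₀) = 1 :=
  bigCharOfV_rationalPairToAdelic F E c N JV JW hJW cV (fun γ => hcV _ ⟨γ, rfl⟩) γ₀

end Adelic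

end LinePair
end HodgeCM

end
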